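import Summits.Ventures.Crystal3D.Theorems.StickyWulffConstantNoReconstructionGainCertificate
import HarnessLib

/-!
# Unit packings in a thin cylindrical shell about an arbitrary axis number `O(ρ)`

HONEST FRAMING. Part of the venture `Summits/Ventures/Crystal3D` (cell `crystal3d-full`), helper
`--supports` the crux `NoReconstructionGain` (stmt-Ventures-19144, route
`route-Ventures-StickyWulffConstant`), line `adhesion`.  Counting only — the RIM bookkeeping for a
general unit normal `ν` (the tree had it only at `ν = e₃`: `card_rim_le` of `…LowCoordRim`):

* `card_le_of_separated_annulus` — packing bound in an annulus of a finite-dimensional real normed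
  space: points at distance `∈ [R₁, R₂]` from `p` with mutual distances `≥ r` satisfy
  `#s · (r/2)^d + (R₁ − r/2)^d ≤ (R₂ + r/2)^d` (disjoint balls between two concentric balls; the
  Haar measure of the unit ball cancels);
* `card_shellBand_le` — in `ℝ³`: a `1`-separated finite set all of whose points have lateral radius
  `‖x‖² − ⟪x,ν⟫² ∈ [(ρ − a)², ρ²]` (`0 ≤ a`, `a + 1 ≤ ρ`) and height `⟪x, ν⟫` in a window of length
  `1/2` has at most `16 (a + 1) ρ` points: project orthogonally onto `(ℝ ∙ ν)ᗮ` (dimension `2`;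
  heights within `1/2` keep the projections `√3/2 > 17/20` apart) and apply the annulus bound.

These give the `C ρ` term when a closure-form certificate (`…NTiltBarlowFilm`, `…OneOverhangFilm`,
`…TwoOverhangFilm`) is run on the `ν`-slab sample: only film balls touching substrate balls within
one bond of the lateral rim are exempt (next file).

WHAT THIS IS NOT: anything about contacts; rung F-C1 not moved.
-/

noncomputable section

namespace Summit.Ventures.Crystal3D.Theorems

open Finset MeasureTheory Metric Module
open scoped InnerProductSpace ENNReal

/-! ### Packing in an annulus -/

open scoped Function in
/-- **Packing bound in an annulus.**  In a finite-dimensional real normed space of dimension `d`,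
finitely many points at distance `∈ [R₁, R₂]` from `p`, `r/2 ≤ R₁ ≤ R₂`, with mutual distances
`≥ r > 0`, satisfy `#s · (r/2)^d + (R₁ − r/2)^d ≤ (R₂ + r/2)^d`. -/
theorem card_le_of_separated_annulus {F : Type*} [NormedAddCommGroup F] [NormedSpace ℝ F]
    [FiniteDimensional ℝ F] (s : Finset F) (p : F) {r R₁ R₂ : ℝ} (hr : 0 < r) (hR₁ : r / 2 ≤ R₁)
    (hR₁₂ : R₁ ≤ R₂)
    (hs : ∀ c ∈ s, R₁ ≤ dist c p ∧ dist c p ≤ R₂) (h : ∀ c ∈ s, ∀ d ∈ s, c ≠ d → r ≤ dist c d) :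
    (s.card : ℝ) * (r / 2) ^ finrank ℝ F + (R₁ - r / 2) ^ finrank ℝ F ≤ (R₂ + r / 2) ^ finrank ℝ F := by
  borelize F
  let μ : Measure F := Measure.addHaar
  set δ : ℝ := r / 2 with hδ
  have δpos : 0 < δ := by positivity
  have ρ₁nn : 0 ≤ R₁ - δ := by linarith
  have ρ₂pos : 0 < R₂ + δ := by linarith
  set A := ⋃ c ∈ s, ball (c : F) δ with hA
  set Cb := closedBall p (R₁ - δ) with hCb
  have D : Set.Pairwise (s : Set F) (Disjoint on fun c => ball (c : F) δ) := by
    rintro c hc d hd hcd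
    apply ball_disjoint_ball
    have := h c hc d hd hcd
    linarith
  have A_subset : A ⊆ ball p (R₂ + δ) := by
    refine Set.iUnion₂_subset fun x hx => ?_
    apply ball_subset_ball'
    linarith [(hs x hx).2]
  have C_subset : Cb ⊆ ball p (R₂ + δ) := closedBall_subset_ball (by linarith)
  have AC : Disjoint A Cb := by
    rw [hA, Set.disjoint_iUnion₂_left]
    intro c hc
    refine Set.disjoint_left.2 fun x hx hxC => ?_
    rw [mem_ball] at hx
    rw [hCb, mem_closedBall] at hxC
    have h1 := (hs c hc).1
    have : dist c p ≤ dist c x + dist x p := dist_triangle _ _ _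
    rw [dist_comm c x] at this
    linarith
  have hmeasC : MeasurableSet Cb := measurableSet_closedBall
  have hunion : μ A + μ Cb ≤ μ (ball p (R₂ + δ)) := by
    rw [← measure_union AC hmeasC]
    exact measure_mono (Set.union_subset A_subset C_subset)
  have hμA : μ A = (s.card : ℝ≥0∞) * ENNReal.ofReal (δ ^ finrank ℝ F) * μ (ball 0 1) := by
    rw [hA, measure_biUnion_finset D fun c _ => measurableSet_ball]
    simp only [μ.addHaar_ball_of_pos _ δpos]
    simp only [Finset.sum_const, nsmul_eq_mul, mul_assoc]
  have hμC : μ Cb = ENNReal.ofReal ((R₁ - δ) ^ finrank ℝ F) * μ (ball 0 1) := by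
    rw [hCb, μ.addHaar_closedBall _ ρ₁nn]
  have hμB : μ (ball p (R₂ + δ)) = ENNReal.ofReal ((R₂ + δ) ^ finrank ℝ F) * μ (ball 0 1) := by
    rw [μ.addHaar_ball_of_pos _ ρ₂pos]
  rw [hμA, hμC, hμB, ← add_mul] at hunion
  have J : (s.card : ℝ≥0∞) * ENNReal.ofReal (δ ^ finrank ℝ F) + ENNReal.ofReal ((R₁ - δ) ^ finrank ℝ F) ≤
      ENNReal.ofReal ((R₂ + δ) ^ finrank ℝ F) :=
    (ENNReal.mul_le_mul_iff_left (measure_ball_pos _ _ zero_lt_one).ne' measure_ball_lt_top.ne).1 hunion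
  have K := ENNReal.toReal_le_of_le_ofReal (pow_nonneg ρ₂pos.le _) J
  rw [ENNReal.toReal_add (by exact ENNReal.mul_ne_top (by simp) ENNReal.ofReal_ne_top) ENNReal.ofReal_ne_top,
    ENNReal.toReal_mul, ENNReal.toReal_ofReal (pow_nonneg δpos.le _),
    ENNReal.toReal_ofReal (pow_nonneg ρ₁nn _)] at K
  simpa using K

/-! ### A half-height band of a thin cylindrical shell in `ℝ³` -/

/-- **Points of a `1`-separated set in a half-height band of a thin shell about the axis `ν`.**
If every point of `S` has `‖x‖² − ⟪x, ν⟫² ∈ [(ρ − a)², ρ²]` and `⟪x, ν⟫ ∈ [c, c + 1/2]` (`‖ν‖ = 1`,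
`0 ≤ a`, `a + 1 ≤ ρ`), then `#S ≤ 16 (a + 1) ρ`. -/
theorem card_shellBand_le (ν : EuclideanSpace ℝ (Fin 3)) (hν : ‖ν‖ = 1)
    (S : Finset (EuclideanSpace ℝ (Fin 3))) (hS : ∀ p ∈ S, ∀ q ∈ S, p ≠ q → 1 ≤ dist p q)
    (ρ a c : ℝ) (ha : 0 ≤ a) (hρ : a + 1 ≤ ρ)
    (hmem : ∀ x ∈ S, (ρ - a) ^ 2 ≤ ‖x‖ ^ 2 - ⟪x, ν⟫_ℝ ^ 2 ∧ ‖x‖ ^ 2 - ⟪x, ν⟫_ℝ ^ 2 ≤ ρ ^ 2 ∧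
      c ≤ ⟪x, ν⟫_ℝ ∧ ⟪x, ν⟫_ℝ ≤ c + 1 / 2) :
    (S.card : ℝ) ≤ 16 * (a + 1) * ρ := by
  classical
  have hν0 : ν ≠ 0 := by
    intro h; rw [h, norm_zero] at hν; exact zero_ne_one hν
  set K : Submodule ℝ (EuclideanSpace ℝ (Fin 3)) := (ℝ ∙ ν)ᗮ with hK
  haveI : Fact (finrank ℝ (EuclideanSpace ℝ (Fin 3)) = 2 + 1) := ⟨by simp⟩
  have hfr : finrank ℝ K = 2 := by
    rw [hK]; exact Submodule.finrank_orthogonal_span_singleton (𝕜 := ℝ) (n := 2) hν0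
  set y : EuclideanSpace ℝ (Fin 3) → K := fun x => K.orthogonalProjectionOnto x with hy
  -- the projection removes exactly the `ν`-component
  have hnorm : ∀ x : EuclideanSpace ℝ (Fin 3), ‖y x‖ ^ 2 = ‖x‖ ^ 2 - ⟪x, ν⟫_ℝ ^ 2 := by
    intro x
    have h1 := Submodule.norm_sq_eq_add_norm_sq_projection x (ℝ ∙ ν)
    have h2' : ‖((ℝ ∙ ν).orthogonalProjectionOnto x : EuclideanSpace ℝ (Fin 3))‖ = |⟪x, ν⟫_ℝ| := by
      rw [Submodule.coe_orthogonalProjectionOnto_apply, Submodule.starProjection_singleton ℝ, norm_smul, hν,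
        real_inner_comm]
      simp
    have h2 : ‖(ℝ ∙ ν).orthogonalProjectionOnto x‖ = |⟪x, ν⟫_ℝ| := by
      rw [← h2', Submodule.coe_norm]
    rw [h2, sq_abs] at h1
    rw [hy]; linarith
  have hlin : ∀ x x' : EuclideanSpace ℝ (Fin 3), y x - y x' = y (x - x') := fun x x' => by
    simp only [hy, map_sub]
  -- projections of distinct points of `S` are `≥ 17/20` apart
  have hsep : ∀ p ∈ S, ∀ q ∈ S, p ≠ q → (17 : ℝ) / 20 ≤ dist (y p) (y q) := by
    intro p hp q hq hpq
    have h1 := hS p hp q hq hpq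
    rw [dist_eq_norm] at h1 ⊢
    rw [hlin, ← abs_of_nonneg (norm_nonneg (y (p - q))), ← abs_of_nonneg (by norm_num : (0 : ℝ) ≤ 17 / 20),
      ← sq_le_sq, hnorm]
    have ht : |⟪p - q, ν⟫_ℝ| ≤ 1 / 2 := by
      rw [inner_sub_left, abs_le]
      obtain ⟨-, -, h3, h4⟩ := hmem p hp
      obtain ⟨-, -, h5, h6⟩ := hmem q hq
      constructor <;> linarith
    have hsq : ⟪p - q, ν⟫_ℝ ^ 2 ≤ 1 / 4 := by
      rw [← sq_abs]; nlinarith [abs_nonneg ⟪p - q, ν⟫_ℝ]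
    nlinarith [norm_nonneg (p - q)]
  have hinj : Set.InjOn y (S : Set (EuclideanSpace ℝ (Fin 3))) := by
    intro p hp q hq hpq
    by_contra hne
    have := hsep p hp q hq hne
    rw [hpq, dist_self] at this
    norm_num at this
  set S' : Finset K := S.image y with hS'
  have hcard : S'.card = S.card := card_image_of_injOn hinj
  -- radii of the projections
  have hρ0 : 0 < ρ - a := by linarith
  have hrad : ∀ z ∈ S', ρ - a ≤ dist z 0 ∧ dist z 0 ≤ ρ := by
    intro z hz
    obtain ⟨x, hx, rfl⟩ := mem_image.1 hz
    obtain ⟨h1, h2, -, -⟩ := hmem x hx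
    rw [dist_zero_right]
    have hn := hnorm x
    have hy0 := norm_nonneg (y x)
    constructor <;> nlinarith
  have hsep' : ∀ z ∈ S', ∀ z' ∈ S', z ≠ z' → (17 : ℝ) / 20 ≤ dist z z' := by
    intro z hz z' hz' hzz
    obtain ⟨p, hp, rfl⟩ := mem_image.1 hz
    obtain ⟨q, hq, rfl⟩ := mem_image.1 hz'
    exact hsep p hp q hq fun e => hzz (by rw [e])
  have hann := card_le_of_separated_annulus S' (0 : K) (r := 17 / 20) (R₁ := ρ - a) (R₂ := ρ)
    (by norm_num) (by linarith) (by linarith) hrad hsep'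
  rw [hfr, hcard] at hann
  nlinarith

end Summit.Ventures.Crystal3D.Theorems

end
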